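import Literature.Topology.PlanarFoliations.LeafArcs
import Literature.Topology.FourManifolds.OneManifoldCompatibleCover
import HarnessLib

/-!
# Leaves of a bi-oriented foliation are oriented one-manifolds: arc charts follow the leaf arcs

Topic: Topology / PlanarFoliations, sequel to `LeafArcs.lean`. For a bi-oriented foliation
`F : Foliation ℝ X` with one-dimensional leaves (`BiOrient.lean`), the leaf arcs of a leaf
`F.Leaf x` are pairwise compatible arc charts (`eventually_lt_iff_leafArc`). Here we show that
the leaf is *oriented by them*:

* `agrees_or_disagrees` (**proved**): every arc chart `g` of the leaf (an open partial
  homeomorphism onto `ℝ`) either **agrees** with all leaf arcs at all points of its source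
  (`AgreesWithLeafArcs`: same local order) or **disagrees** with all of them
  (`DisagreesWithLeafArcs`: opposite local order). On each component of an overlap the transition
  to a leaf arc is monotone (`OneManifold.transition_strictMonoOn_or_strictAntiOn`), the sets of
  points of agreement and of disagreement are open and disjoint (compatibility of the leaf
  arcs), and the source of an arc chart is connected;
* `agreesWithLeafArcs_neg` (**proved**): reflecting a disagreeing chart makes it agree;
* `exists_two_agreeing_arcCharts` (**proved**): **a compact leaf is covered by two arc charts
  agreeing with the leaf arcs** — the tree's compact case of Milnor's classification
  (`OneManifold.exists_two_compatible_arcCharts`, `OneManifoldTwoCharts.lean`) followed by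
  reflections; two agreeing charts are automatically compatible with each other
  (`eventually_lt_iff_of_agrees`).

References: Milnor, *Topology from the Differentiable Viewpoint* (1965), Appendix; the use for
leaves of foliations is [folklore] (Camacho–Lins Neto, Ch. VI §4; Hector–Hirsch A, Ch. II 2.2).
-/

noncomputable section

open Set Filter Function
open _root_.Topology
open Literature.Topology.FourManifolds Literature.Topology.FourManifolds.Foliation
  Literature.Topology.FourManifolds.OneManifold

namespace Literature.Topology.PlanarFoliations

/-! ## Local agreement of a real chart with an arc (generic one-dimensional spaces) -/

section Generic

variable {M : Type*} [TopologicalSpace M]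

/-- `g` **agrees locally** with `c` at `p`: near `p` they induce the same order with respect
to `p`. [folklore] -/
def LocAgree (g c : OpenPartialHomeomorph M ℝ) (p : M) : Prop :=
  ∀ᶠ q in 𝓝 p, (g q < g p ↔ c q < c p) ∧ (g p < g q ↔ c p < c q)

/-- `g` **disagrees locally** with `c` at `p`: near `p` they induce opposite orders with respect
to `p`. [folklore] -/
def LocDisagree (g c : OpenPartialHomeomorph M ℝ) (p : M) : Prop :=
  ∀ᶠ q in 𝓝 p, (g q < g p ↔ c p < c q) ∧ (g p < g q ↔ c q < c p)

variable {g c c' : OpenPartialHomeomorph M ℝ} {p : M}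

/-- Points of an arc chart arbitrarily close to `p` on its left: `c.symm (c p - ε) → p` with
`c`-coordinate `< c p`; so no neighbourhood of `p` has all its points at `c`-level `≥ c p`.
[folklore] -/
theorem frequently_lt (hc : c.target = univ) (hp : p ∈ c.source) : ∃ᶠ q in 𝓝 p, c q < c p := by
  rw [frequently_iff]
  intro U hU
  have hcs : ContinuousAt c.symm (c p) := arc_continuousAt_symm hc _
  have hU' : c.symm ⁻¹' U ∈ 𝓝 (c p) := hcs.preimage_mem_nhds (by rwa [c.left_inv hp])
  obtain ⟨ε, hε, hball⟩ := Metric.mem_nhds_iff.1 hU'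
  refine ⟨c.symm (c p - ε / 2), hball ?_, ?_⟩
  · rw [Metric.mem_ball, Real.dist_eq, show c p - ε / 2 - c p = -(ε / 2) by ring, abs_neg,
      abs_of_pos (by positivity)]
    linarith
  · rw [arc_apply_symm hc]
    linarith

/-- A chart cannot both agree and disagree locally with an arc chart at a point of the arc.
[folklore] -/
theorem not_locAgree_of_locDisagree (hc : c.target = univ) (hp : p ∈ c.source) (h₁ : LocAgree g c p)
    (h₂ : LocDisagree g c p) : False := by
  have h := (h₁.and h₂).mono fun q ⟨hq₁, hq₂⟩ ↦ (show ¬ c q < c p from fun hlt ↦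
    lt_asymm hlt ((hq₂.1).1 ((hq₁.1).2 hlt)))
  exact (frequently_lt hc hp).and_eventually h |>.mono (fun q ⟨hq, hq'⟩ ↦ hq' hq) |>.exists.elim
    fun _ h ↦ h

/-- Local agreement transfers along compatible arcs: if `c` and `c'` are compatible at `p` then
agreeing with `c` is agreeing with `c'`. [folklore] -/
theorem LocAgree.trans (h : LocAgree g c p)
    (hcc' : ∀ᶠ q in 𝓝 p, (c q < c p ↔ c' q < c' p) ∧ (c p < c q ↔ c' p < c' q)) : LocAgree g c' p :=
  (h.and hcc').mono fun _ ⟨h₁, h₂⟩ ↦ ⟨h₁.1.trans h₂.1, h₁.2.trans h₂.2⟩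

/-- Local disagreement transfers along compatible arcs. [folklore] -/
theorem LocDisagree.trans (h : LocDisagree g c p)
    (hcc' : ∀ᶠ q in 𝓝 p, (c q < c p ↔ c' q < c' p) ∧ (c p < c q ↔ c' p < c' q)) : LocDisagree g c' p :=
  (h.and hcc').mono fun _ ⟨h₁, h₂⟩ ↦ ⟨h₁.1.trans h₂.2, h₁.2.trans h₂.1⟩

/-- Agreement followed by disagreement is disagreement. [folklore] -/
theorem LocAgree.trans_locDisagree {g' : OpenPartialHomeomorph M ℝ} (h : LocAgree g g' p) (h' : LocDisagree g' c p) :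
    LocDisagree g c p :=
  (h.and h').mono fun _ ⟨h₁, h₂⟩ ↦ ⟨h₁.1.trans h₂.1, h₁.2.trans h₂.2⟩

/-- Disagreeing with `c` is agreeing with the reflected chart `-g`. [folklore] -/
theorem LocDisagree.neg (h : LocDisagree g c p) : LocAgree (g.transHomeomorph (Homeomorph.neg ℝ)) c p :=
  h.mono fun q hq ↦ by
    simp only [neg_chart_apply, neg_lt_neg_iff]
    exact ⟨hq.2, hq.1⟩

/-- Agreeing with `c` is disagreeing with the reflected chart `-g`... read the other way: the
reflection of an agreeing chart disagrees. [folklore] -/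
theorem LocAgree.neg (h : LocAgree g c p) : LocDisagree (g.transHomeomorph (Homeomorph.neg ℝ)) c p :=
  h.mono fun q hq ↦ by
    simp only [neg_chart_apply, neg_lt_neg_iff]
    exact ⟨hq.2, hq.1⟩

/-- **On a component of the overlap, an arc chart agrees everywhere or disagrees everywhere
with another arc chart** (the transition is strictly monotone on the component,
`OneManifold.transition_strictMonoOn_or_strictAntiOn`). [folklore] -/
theorem locAgree_or_locDisagree_on_component [LocallyConnectedSpace M] (hg : g.target = univ)
    (c : OpenPartialHomeomorph M ℝ) (p : M) :
    (∀ p' ∈ connectedComponentIn (g.source ∩ c.source) p, LocAgree g c p') ∨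
      (∀ p' ∈ connectedComponentIn (g.source ∩ c.source) p, LocDisagree g c p') := by
  set K := connectedComponentIn (g.source ∩ c.source) p with hK
  have hKo : IsOpen K := (g.open_source.inter c.open_source).connectedComponentIn
  have hKg : K ⊆ g.source := (connectedComponentIn_subset _ _).trans inter_subset_left
  have hAo : IsOpen (g '' K) := g.isOpen_image_of_subset_source hKo hKg
  have hAt : g '' K ⊆ g.target := by rw [hg]; exact subset_univ _
  have hmem : ∀ p' ∈ K, p' ∈ g.symm '' (g '' K) := fun p' hp' ↦
    ⟨g p', mem_image_of_mem g hp', g.left_inv (hKg hp')⟩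
  rcases transition_strictMonoOn_or_strictAntiOn hg c p with hm | ha
  · exact Or.inl fun p' hp' ↦ eventually_lt_iff_of_strictMonoOn hAo hAt hm (hmem p' hp')
  · right
    intro p' hp'
    have h := eventually_lt_iff_of_strictMonoOn (c := c.transHomeomorph (Homeomorph.neg ℝ)) hAo hAt
      (strictMonoOn_neg_of_strictAntiOn ha) (hmem p' hp')
    exact h.mono fun q hq ↦ by
      simp only [neg_chart_apply, neg_lt_neg_iff] at hq
      exact hq

end Generic

/-! ## Agreement with the leaf arcs -/

section Leaf

variable {X : Type*} [TopologicalSpace X] {F : Foliation ℝ X} {x : X}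
variable {g : OpenPartialHomeomorph (F.Leaf x) ℝ} {p : F.Leaf x}

/-- A leaf is locally connected in its leaf topology. [folklore] -/
instance Leaf.instLocallyConnectedSpace (F : Foliation ℝ X) (x : X) : LocallyConnectedSpace (F.Leaf x) :=
  (F.isOpen_preimage_leaf x).locallyConnectedSpace

/-- `g` **agrees with the leaf arcs**: at every point of its source it induces the same local
order as every leaf arc through that point. [folklore] -/
def AgreesWithLeafArcs (g : OpenPartialHomeomorph (F.Leaf x) ℝ) : Prop :=
  ∀ p ∈ g.source, ∀ (e : OpenPartialHomeomorph X (ℝ × ℝ)) (he : e ∈ F.atlas) (t : ℝ) (h : plaque e t ⊆ F.leaf x),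
    p ∈ (leafArc e t h he).source → LocAgree g (leafArc e t h he) p

/-- `g` **disagrees with the leaf arcs**: at every point of its source it induces the opposite
local order to every leaf arc through that point. [folklore] -/
def DisagreesWithLeafArcs (g : OpenPartialHomeomorph (F.Leaf x) ℝ) : Prop :=
  ∀ p ∈ g.source, ∀ (e : OpenPartialHomeomorph X (ℝ × ℝ)) (he : e ∈ F.atlas) (t : ℝ) (h : plaque e t ⊆ F.leaf x),
    p ∈ (leafArc e t h he).source → LocDisagree g (leafArc e t h he) p

/-- **Every arc chart of a leaf of a bi-oriented foliation agrees or disagrees with the leaf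
arcs** (globally on its connected source). [folklore] -/
theorem agrees_or_disagrees (hbi : IsBiOriented F) (hg : g.target = univ) :
    AgreesWithLeafArcs g ∨ DisagreesWithLeafArcs g := by
  -- points of agreement / disagreement with SOME leaf arc through them
  set S : Set (F.Leaf x) := {p | p ∈ g.source ∧ ∃ (e : OpenPartialHomeomorph X (ℝ × ℝ)) (he : e ∈ F.atlas)
    (t : ℝ) (h : plaque e t ⊆ F.leaf x), p ∈ (leafArc e t h he).source ∧ LocAgree g (leafArc e t h he) p} with hS
  set S' : Set (F.Leaf x) := {p | p ∈ g.source ∧ ∃ (e : OpenPartialHomeomorph X (ℝ × ℝ)) (he : e ∈ F.atlas)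
    (t : ℝ) (h : plaque e t ⊆ F.leaf x), p ∈ (leafArc e t h he).source ∧ LocDisagree g (leafArc e t h he) p} with hS'
  -- agreement / disagreement with some leaf arc transfers to every leaf arc through the point
  have htransS : ∀ p ∈ S, ∀ (e : OpenPartialHomeomorph X (ℝ × ℝ)) (he : e ∈ F.atlas) (t : ℝ)
      (h : plaque e t ⊆ F.leaf x), p ∈ (leafArc e t h he).source → LocAgree g (leafArc e t h he) p := by
    rintro p ⟨-, e₀, he₀, t₀, h₀, hp₀, hag⟩ e he t h hp
    exact hag.trans (eventually_lt_iff_leafArc hbi h₀ he₀ h he hp₀ hp)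
  have htransS' : ∀ p ∈ S', ∀ (e : OpenPartialHomeomorph X (ℝ × ℝ)) (he : e ∈ F.atlas) (t : ℝ)
      (h : plaque e t ⊆ F.leaf x), p ∈ (leafArc e t h he).source → LocDisagree g (leafArc e t h he) p := by
    rintro p ⟨-, e₀, he₀, t₀, h₀, hp₀, hag⟩ e he t h hp
    exact hag.trans (eventually_lt_iff_leafArc hbi h₀ he₀ h he hp₀ hp)
  -- `S` and `S'` are disjoint
  have hdisj : Disjoint S S' := by
    rw [Set.disjoint_left]
    rintro p hpS ⟨-, e, he, t, h, hp, hdis⟩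
    exact not_locAgree_of_locDisagree (leafArc_target h he) hp (htransS p hpS e he t h hp) hdis
  -- `S ∪ S' ⊇ g.source`
  have hcover : g.source ⊆ S ∪ S' := by
    intro p hpg
    obtain ⟨e, he, t, h, hp⟩ := exists_mem_leafArc_source p
    rcases locAgree_or_locDisagree_on_component hg (leafArc e t h he) p with hA | hD
    · exact Or.inl ⟨hpg, e, he, t, h, hp, hA p (mem_connectedComponentIn ⟨hpg, hp⟩)⟩
    · exact Or.inr ⟨hpg, e, he, t, h, hp, hD p (mem_connectedComponentIn ⟨hpg, hp⟩)⟩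
  -- `S` and `S'` are open
  have hopen : ∀ (T : Set (F.Leaf x)), (T = S ∨ T = S') → IsOpen T := by
    -- a uniform argument: around a point of `S` (resp. `S'`) the whole component of the overlap
    -- with the witnessing leaf arc lies in `S` (resp. `S'`)
    rintro T (rfl | rfl)
    · refine isOpen_iff_mem_nhds.2 ?_
      rintro p ⟨hpg, e, he, t, h, hp, hag⟩
      set K := connectedComponentIn (g.source ∩ (leafArc e t h he).source) p with hK
      have hKo : IsOpen K := (g.open_source.inter (leafArc e t h he).open_source).connectedComponentIn
      have hpK : p ∈ K := mem_connectedComponentIn ⟨hpg, hp⟩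
      rcases locAgree_or_locDisagree_on_component hg (leafArc e t h he) p with hA | hD
      · filter_upwards [hKo.mem_nhds hpK] with q hq
        have hq' := connectedComponentIn_subset _ _ hq
        exact ⟨hq'.1, e, he, t, h, hq'.2, hA q hq⟩
      · exact (not_locAgree_of_locDisagree (leafArc_target h he) hp hag (hD p hpK)).elim
    · refine isOpen_iff_mem_nhds.2 ?_
      rintro p ⟨hpg, e, he, t, h, hp, hdis⟩
      set K := connectedComponentIn (g.source ∩ (leafArc e t h he).source) p with hK
      have hKo : IsOpen K := (g.open_source.inter (leafArc e t h he).open_source).connectedComponentIn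
      have hpK : p ∈ K := mem_connectedComponentIn ⟨hpg, hp⟩
      rcases locAgree_or_locDisagree_on_component hg (leafArc e t h he) p with hA | hD
      · exact (not_locAgree_of_locDisagree (leafArc_target h he) hp (hA p hpK) hdis).elim
      · filter_upwards [hKo.mem_nhds hpK] with q hq
        have hq' := connectedComponentIn_subset _ _ hq
        exact ⟨hq'.1, e, he, t, h, hq'.2, hD q hq⟩
  -- connectedness of the source
  rcases (arc_isConnected_source hg).isPreconnected.subset_or_subset (hopen S (Or.inl rfl))
      (hopen S' (Or.inr rfl)) hdisj hcover with hsub | hsub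
  · exact Or.inl fun p hp e he t h hpc ↦ htransS p (hsub hp) e he t h hpc
  · exact Or.inr fun p hp e he t h hpc ↦ htransS' p (hsub hp) e he t h hpc

/-- **Reflecting a disagreeing chart gives an agreeing chart.** [folklore] -/
theorem agreesWithLeafArcs_neg (h : DisagreesWithLeafArcs g) :
    AgreesWithLeafArcs (g.transHomeomorph (Homeomorph.neg ℝ)) :=
  fun p hp e he t h' hpc ↦ (h p hp e he t h' hpc).neg

/-- **Two charts agreeing with the leaf arcs are compatible with each other** (through a leaf
arc at each common point). [folklore] -/
theorem eventually_lt_iff_of_agrees {g₁ g₂ : OpenPartialHomeomorph (F.Leaf x) ℝ} (h₁ : AgreesWithLeafArcs g₁)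
    (h₂ : AgreesWithLeafArcs g₂) (hp : p ∈ g₁.source ∩ g₂.source) :
    ∀ᶠ q in 𝓝 p, (g₁ q < g₁ p ↔ g₂ q < g₂ p) ∧ (g₁ p < g₁ q ↔ g₂ p < g₂ q) := by
  obtain ⟨e, he, t, h, hpc⟩ := exists_mem_leafArc_source p
  have a₁ := h₁ p hp.1 e he t h hpc
  have a₂ := h₂ p hp.2 e he t h hpc
  exact (a₁.and a₂).mono fun q ⟨hq₁, hq₂⟩ ↦ ⟨hq₁.1.trans hq₂.1.symm, hq₁.2.trans hq₂.2.symm⟩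

/-! ## Compact leaves: two agreeing arc charts -/

/-- **A compact leaf of a bi-oriented foliation is covered by two arc charts agreeing with the
leaf arcs** (Milnor's classification, compact case, in the tree's topological form
`OneManifold.exists_two_compatible_arcCharts`, followed by reflecting the charts that disagree
with the leaf arcs). The two charts are then compatible with each other
(`eventually_lt_iff_of_agrees`): the leaf is an oriented circle.
[cite: MilnorTDV1965, Appendix (Classifying 1-manifolds), Theorem pp. 56–57] -/
theorem exists_two_agreeing_arcCharts [T2Space X] [CompactSpace (F.Leaf x)] (hbi : IsBiOriented F) :
    ∃ g₁ g₂ : OpenPartialHomeomorph (F.Leaf x) ℝ, g₁.target = univ ∧ g₂.target = univ ∧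
      g₁.source ∪ g₂.source = univ ∧ AgreesWithLeafArcs g₁ ∧ AgreesWithLeafArcs g₂ := by
  have harc : ∀ p : F.Leaf x, ∃ c : OpenPartialHomeomorph (F.Leaf x) ℝ, c.target = univ ∧ p ∈ c.source := fun p ↦ by
    obtain ⟨e, he, t, h, hp⟩ := exists_mem_leafArc_source p
    exact ⟨leafArc e t h he, leafArc_target h he, hp⟩
  obtain ⟨g₁, g₂, hg₁, hg₂, hcov, -⟩ := exists_two_compatible_arcCharts harc
  -- reorient each chart if necessary
  have fix : ∀ g : OpenPartialHomeomorph (F.Leaf x) ℝ, g.target = univ →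
      ∃ g' : OpenPartialHomeomorph (F.Leaf x) ℝ, g'.target = univ ∧ g'.source = g.source ∧ AgreesWithLeafArcs g' := by
    intro g hg
    rcases agrees_or_disagrees hbi hg with h | h
    · exact ⟨g, hg, rfl, h⟩
    · exact ⟨g.transHomeomorph (Homeomorph.neg ℝ), neg_chart_target hg, neg_chart_source g, agreesWithLeafArcs_neg h⟩
  obtain ⟨g₁', hg₁', hs₁, ha₁⟩ := fix g₁ hg₁
  obtain ⟨g₂', hg₂', hs₂, ha₂⟩ := fix g₂ hg₂
  exact ⟨g₁', g₂', hg₁', hg₂', by rw [hs₁, hs₂, hcov], ha₁, ha₂⟩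

end Leaf

/-! ## Non-compact spaces: a compatible covering pair glues to a global arc chart -/

section NoncompactPair

variable {M : Type*} [TopologicalSpace M] [T2Space M] [LocallyConnectedSpace M] [ConnectedSpace M]
  {e f : OpenPartialHomeomorph M ℝ} {p : M}

omit [LocallyConnectedSpace M] in
/-- **Two ends force compactness.** In the configuration of Milnor's lemma with two components
(the right end of `e` glued increasingly to the left end of `f`, and the left end of `e` glued
increasingly to the right end of `f`), `M` is the union of two compact arcs, hence compact — a
contradiction in a non-compact space (compare `OneManifold.union_eq_univ_of_two_ends`, whose
proof this follows). [cite: MilnorTDV1965, Appendix (Classifying 1-manifolds), Lemma p. 56] -/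
theorem false_of_two_ends [NoncompactSpace M] (he : e.target = univ) (hf : f.target = univ)
    {a₁ a₂ b₁ b₂ : ℝ} (ha : a₂ ≤ a₁)
    (h₁ : e.symm '' Ioi a₁ = f.symm '' Iio b₁) (h₂ : e.symm '' Iio a₂ = f.symm '' Ioi b₂)
    (hm₁ : StrictMonoOn (e ∘ f.symm) (Iio b₁)) (hm₂ : StrictMonoOn (e ∘ f.symm) (Ioi b₂)) : False := by
  have hcov := union_eq_univ_of_two_ends he hf ha h₁ h₂ hm₁ hm₂
  set t₁ := e (f.symm (b₁ - 1)) with ht₁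
  set t₂ := e (f.symm (b₂ + 1)) with ht₂
  have ht₁a : a₁ < t₁ := by
    obtain ⟨t, ht, hts⟩ : f.symm (b₁ - 1) ∈ e.symm '' Ioi a₁ :=
      h₁ ▸ mem_image_of_mem _ (show b₁ - 1 < b₁ by linarith)
    rw [ht₁, ← hts, arc_apply_symm he]
    exact ht
  have ht₂a : t₂ < a₂ := by
    obtain ⟨t, ht, hts⟩ : f.symm (b₂ + 1) ∈ e.symm '' Iio a₂ :=
      h₂ ▸ mem_image_of_mem _ (show b₂ < b₂ + 1 by linarith)
    rw [ht₂, ← hts, arc_apply_symm he]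
    exact ht
  have hcpt : IsCompact (e.symm '' Icc t₂ t₁ ∪ f.symm '' Icc (b₁ - 1) (b₂ + 1)) :=
    (isCompact_Icc.image (arc_continuous_symm he)).union (isCompact_Icc.image (arc_continuous_symm hf))
  have hfsrc : ∀ q ∈ f.source, q ∈ e.symm '' Icc t₂ t₁ ∪ f.symm '' Icc (b₁ - 1) (b₂ + 1) := by
    intro q hq
    rcases lt_or_ge (f q) (b₁ - 1) with hs | hs
    · have hq₁ : q ∈ e.symm '' Ioi a₁ := by
        rw [h₁]
        exact ⟨f q, (by linarith : f q < b₁), f.left_inv hq⟩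
      obtain ⟨t, ht, rfl⟩ := hq₁
      refine Or.inl ⟨t, ⟨?_, ?_⟩, rfl⟩
      · have := mem_Ioi.1 ht
        linarith
      · have hlt : (e ∘ f.symm) (f (e.symm t)) < (e ∘ f.symm) (b₁ - 1) :=
          hm₁ (by linarith : f (e.symm t) < b₁) (by linarith : b₁ - 1 < b₁) hs
        simp only [Function.comp_apply, f.left_inv hq, arc_apply_symm he] at hlt
        exact hlt.le
    rcases le_or_gt (f q) (b₂ + 1) with hs' | hs'
    · exact Or.inr ⟨f q, ⟨hs, hs'⟩, f.left_inv hq⟩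
    · have hq₂ : q ∈ e.symm '' Iio a₂ := by
        rw [h₂]
        exact ⟨f q, (by linarith : b₂ < f q), f.left_inv hq⟩
      obtain ⟨t, ht, rfl⟩ := hq₂
      refine Or.inl ⟨t, ⟨?_, ?_⟩, rfl⟩
      · have hlt : (e ∘ f.symm) (b₂ + 1) < (e ∘ f.symm) (f (e.symm t)) :=
          hm₂ (by linarith : b₂ < b₂ + 1) (by linarith : b₂ < f (e.symm t)) hs'
        simp only [Function.comp_apply, f.left_inv hq, arc_apply_symm he] at hlt
        exact hlt.le
      · have := mem_Iio.1 ht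
        linarith
  have huniv : (univ : Set M) ⊆ e.symm '' Icc t₂ t₁ ∪ f.symm '' Icc (b₁ - 1) (b₂ + 1) := by
    rw [← hcov]
    rintro q (hq | hq)
    · by_cases hqf : q ∈ f.source
      · exact hfsrc q hqf
      · refine Or.inl ⟨e q, ⟨?_, ?_⟩, e.left_inv hq⟩
        · by_contra hlt
          push Not at hlt
          have : q ∈ f.symm '' Ioi b₂ := by
            rw [← h₂]
            exact ⟨e q, hlt.trans ht₂a, e.left_inv hq⟩
          obtain ⟨s, -, rfl⟩ := this
          exact hqf (arc_symm_mem hf s)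
        · by_contra hlt
          push Not at hlt
          have : q ∈ f.symm '' Iio b₁ := by
            rw [← h₁]
            exact ⟨e q, ht₁a.trans hlt, e.left_inv hq⟩
          obtain ⟨s, -, rfl⟩ := this
          exact hqf (arc_symm_mem hf s)
    · exact hfsrc q hq
  exact noncompact_univ M (hcpt.of_isClosed_subset isClosed_univ huniv)

/-- **Milnor's lemma in a non-compact space, core case**: two arc charts, neither source inside
the other, whose overlap has a component equal to the right end of `e` and the left end of `f`
with increasing transition, glue to an arc chart on `e.source ∪ f.source` (a second component
would force compactness, `false_of_two_ends`). [cite: MilnorTDV1965, Appendix (Classifying 1-manifolds), Lemma p. 56] -/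
theorem exists_arcChart_union_of_core [NoncompactSpace M] (he : e.target = univ) (hf : f.target = univ)
    (hef : ¬e.source ⊆ f.source) (hfe : ¬f.source ⊆ e.source)
    {a₁ b₁ : ℝ} (hA : e '' connectedComponentIn (e.source ∩ f.source) p = Ioi a₁)
    (hB : f '' connectedComponentIn (e.source ∩ f.source) p = Iio b₁)
    (hmono : StrictMonoOn (f ∘ e.symm) (e '' connectedComponentIn (e.source ∩ f.source) p)) :
    ∃ e' : OpenPartialHomeomorph M ℝ, e'.target = univ ∧ e'.source = e.source ∪ f.source := by
  set K₁ := connectedComponentIn (e.source ∩ f.source) p with hK₁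
  have hK₁sub : K₁ ⊆ e.source ∩ f.source := connectedComponentIn_subset _ _
  have hK₁e : K₁ ⊆ e.source := hK₁sub.trans inter_subset_left
  have hK₁f : K₁ ⊆ f.source := hK₁sub.trans inter_subset_right
  have hK₁eq : K₁ = e.symm '' Ioi a₁ := eq_symm_image_of_image_eq hK₁e hA
  have hK₁eq' : K₁ = f.symm '' Iio b₁ := eq_symm_image_of_image_eq hK₁f hB
  have hmono₁ : StrictMonoOn (f ∘ e.symm) (Ioi a₁) := hA ▸ hmono
  have himg₁ : (f ∘ e.symm) '' Ioi a₁ = Iio b₁ := image_comp_symm_eq hK₁e hA hB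
  by_cases hone : e.source ∩ f.source ⊆ K₁
  · exact exists_arcChart_union he hf ((hone.antisymm hK₁sub).trans hK₁eq) hmono₁ himg₁
  -- two components: impossible
  exfalso
  obtain ⟨p', hp', hp'K⟩ := not_subset.1 hone
  have hd : Disjoint K₁ (connectedComponentIn (e.source ∩ f.source) p') := disjoint_connectedComponentIn hp'K
  obtain ⟨a₂, b₂, hA₂, hB₂, hmono₂⟩ := second_component he hf hef hfe hp' hA hB hd
  set K₂ := connectedComponentIn (e.source ∩ f.source) p' with hK₂
  have hK₂e : K₂ ⊆ e.source := (connectedComponentIn_subset _ _).trans inter_subset_left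
  have hK₂f : K₂ ⊆ f.source := (connectedComponentIn_subset _ _).trans inter_subset_right
  have hK₂eq : K₂ = e.symm '' Iio a₂ := eq_symm_image_of_image_eq hK₂e hA₂
  have hK₂eq' : K₂ = f.symm '' Ioi b₂ := eq_symm_image_of_image_eq hK₂f hB₂
  have hmono₂' : StrictMonoOn (f ∘ e.symm) (Iio a₂) := hA₂ ▸ hmono₂
  have himg₂ : (f ∘ e.symm) '' Iio a₂ = Ioi b₂ := image_comp_symm_eq hK₂e hA₂ hB₂
  have hinv₁ : StrictMonoOn (e ∘ f.symm) (Iio b₁) := by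
    have key := strictMonoOn_of_leftInvOn (h := e ∘ f.symm) hmono₁ fun t ht ↦ by
      have hmem : e.symm t ∈ K₁ := by rw [hK₁eq]; exact mem_image_of_mem _ ht
      simp only [Function.comp_apply, f.left_inv (hK₁f hmem), arc_apply_symm he]
    rwa [himg₁] at key
  have hinv₂ : StrictMonoOn (e ∘ f.symm) (Ioi b₂) := by
    have key := strictMonoOn_of_leftInvOn (h := e ∘ f.symm) hmono₂' fun t ht ↦ by
      have hmem : e.symm t ∈ K₂ := by rw [hK₂eq]; exact mem_image_of_mem _ ht
      simp only [Function.comp_apply, f.left_inv (hK₂f hmem), arc_apply_symm he]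
    rwa [himg₂] at key
  have ha : a₂ ≤ a₁ := le_of_disjoint_ends (by rwa [← hK₁eq, ← hK₂eq])
  exact false_of_two_ends he hf ha (hK₁eq.symm.trans hK₁eq') (hK₂eq.symm.trans hK₂eq') hinv₁ hinv₂

/-- The same with the component being the left end of `e` and the right end of `f`: reflect both
charts. [cite: MilnorTDV1965, Appendix (Classifying 1-manifolds), Lemma p. 56] -/
theorem exists_arcChart_union_of_mirror [NoncompactSpace M] (he : e.target = univ) (hf : f.target = univ)
    (hef : ¬e.source ⊆ f.source) (hfe : ¬f.source ⊆ e.source)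
    {a b : ℝ} (hA : e '' connectedComponentIn (e.source ∩ f.source) p = Iio a)
    (hB : f '' connectedComponentIn (e.source ∩ f.source) p = Ioi b)
    (hmono : StrictMonoOn (f ∘ e.symm) (e '' connectedComponentIn (e.source ∩ f.source) p)) :
    ∃ e' : OpenPartialHomeomorph M ℝ, e'.target = univ ∧ e'.source = e.source ∪ f.source := by
  have hAR : e.transHomeomorph (Homeomorph.neg ℝ) ''
      connectedComponentIn ((e.transHomeomorph (Homeomorph.neg ℝ)).source ∩
        (f.transHomeomorph (Homeomorph.neg ℝ)).source) p = Ioi (-a) := by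
    rw [neg_chart_source, neg_chart_source, neg_chart_image, hA]
    ext t
    rw [Set.mem_neg, mem_Iio, mem_Ioi, neg_lt]
  have hBR : f.transHomeomorph (Homeomorph.neg ℝ) ''
      connectedComponentIn ((e.transHomeomorph (Homeomorph.neg ℝ)).source ∩
        (f.transHomeomorph (Homeomorph.neg ℝ)).source) p = Iio (-b) := by
    rw [neg_chart_source, neg_chart_source, neg_chart_image, hB]
    ext t
    rw [Set.mem_neg, mem_Ioi, mem_Iio, lt_neg]
  obtain ⟨e', he', hsrc⟩ := exists_arcChart_union_of_core (neg_chart_target he) (neg_chart_target hf) hef hfe hAR hBR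
    (strictMonoOn_neg_neg hmono)
  exact ⟨e', he', hsrc⟩

/-- **A compatible covering pair of arc charts of a non-compact connected space glues to a
global arc chart.** If the arc charts `e`, `f` cover `M` and induce the same local order on
their overlap, then one of the sources is everything or the two arcs glue (Milnor's lemma; the
two-component alternative would make `M` compact). [cite: MilnorTDV1965, Appendix (Classifying 1-manifolds), Lemma p. 56] -/
theorem exists_global_arcChart_of_pair [NoncompactSpace M] (he : e.target = univ) (hf : f.target = univ)
    (hcov : e.source ∪ f.source = univ)
    (hcompat : ∀ q ∈ e.source ∩ f.source, ∀ᶠ r in 𝓝 q, (e r < e q ↔ f r < f q) ∧ (e q < e r ↔ f q < f r)) :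
    ∃ g : OpenPartialHomeomorph M ℝ, g.target = univ ∧ g.source = univ := by
  by_cases hfe : f.source ⊆ e.source
  · exact ⟨e, he, by rw [← hcov, union_eq_self_of_subset_right hfe]⟩
  by_cases hef : e.source ⊆ f.source
  · exact ⟨f, hf, by rw [← hcov, union_eq_self_of_subset_left hef]⟩
  -- the overlap is nonempty (connectedness)
  have hne : (e.source ∩ f.source).Nonempty := by
    by_contra hempty
    rw [not_nonempty_iff_eq_empty] at hempty
    have hclopen : IsClopen e.source := by
      refine ⟨⟨?_⟩, e.open_source⟩
      have : e.sourceᶜ = f.source := by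
        apply Subset.antisymm
        · intro q hq
          have : q ∈ e.source ∪ f.source := by rw [hcov]; exact mem_univ _
          exact this.resolve_left hq
        · intro q hq hqe
          have : q ∈ e.source ∩ f.source := ⟨hqe, hq⟩
          rw [hempty] at this
          exact this
      rw [this]
      exact f.open_source
    rcases isClopen_iff.1 hclopen with h | h
    · exact (arc_source_nonempty he).ne_empty h
    · exact hfe (h ▸ subset_univ _)
  obtain ⟨p, hp⟩ := hne
  -- the transition is increasing on the component of `p` (decreasing contradicts compatibility)
  rcases transition_strictMonoOn_or_strictAntiOn he f p with hm | ha
  · rcases overlap_cases he hf hp hm with h | h | ⟨a₁, b₁, hA, hB⟩ | ⟨a, b, hA, hB⟩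
    · exact absurd h hef
    · exact absurd h hfe
    · obtain ⟨g, hg, hsrc⟩ := exists_arcChart_union_of_core he hf hef hfe hA hB hm
      exact ⟨g, hg, hsrc.trans hcov⟩
    · obtain ⟨g, hg, hsrc⟩ := exists_arcChart_union_of_mirror he hf hef hfe hA hB hm
      exact ⟨g, hg, hsrc.trans hcov⟩
  · exfalso
    rcases locAgree_or_locDisagree_on_component he f p with hA | hD
    · -- the component-wise lemma says "agree", but the transition is decreasing: recompute
      have hKo : IsOpen (e '' connectedComponentIn (e.source ∩ f.source) p) :=
        e.isOpen_image_of_subset_source ((e.open_source.inter f.open_source).connectedComponentIn)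
          ((connectedComponentIn_subset _ _).trans inter_subset_left)
      have hdis : LocDisagree e f p := by
        have h := eventually_lt_iff_of_strictMonoOn (c := f.transHomeomorph (Homeomorph.neg ℝ)) hKo
          (by rw [he]; exact subset_univ _) (strictMonoOn_neg_of_strictAntiOn ha)
          ⟨e p, mem_image_of_mem e (mem_connectedComponentIn hp), e.left_inv hp.1⟩
        exact h.mono fun q hq ↦ by
          simp only [neg_chart_apply, neg_lt_neg_iff] at hq
          exact hq
      exact not_locAgree_of_locDisagree hf hp.2 (hcompat p hp) hdis
    · exact not_locAgree_of_locDisagree hf hp.2 (hcompat p hp) (hD p (mem_connectedComponentIn hp))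

end NoncompactPair

/-! ## Non-compact leaves: nested exhausting leaf-oriented arc charts -/

section OpenLeaf

variable {X : Type*} [TopologicalSpace X] {F : Foliation ℝ X} {x : X}

/-- The transition between the reflections of two charts is increasing when the transition
between the charts is. [folklore] -/
theorem strictMono_neg_transition {g g' : OpenPartialHomeomorph (F.Leaf x) ℝ} (h : StrictMono (g' ∘ g.symm)) :
    StrictMono (g'.transHomeomorph (Homeomorph.neg ℝ) ∘ (g.transHomeomorph (Homeomorph.neg ℝ)).symm) := by
  intro s t hst
  simp only [Function.comp_apply, neg_chart_apply, neg_chart_symm_apply, neg_lt_neg_iff]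
  exact h (neg_lt_neg hst)

/-- **A non-compact leaf of a bi-oriented foliation is exhausted by a nested sequence of arc
charts agreeing with the leaf arcs, with increasing transitions** (Milnor's maximality argument
in the tree's countable form `OneManifold.exists_arcCharts_nat_of_not_cover`; its hypothesis — no
compatible covering pair — holds or else such a pair glues to a single global chart,
`exists_global_arcChart_of_pair`; the charts are then reflected all at once if they disagree with
the leaf arcs). The leaf is an oriented line.
[cite: MilnorTDV1965, Appendix (Classifying 1-manifolds), Theorem pp. 56–57] -/
theorem exists_nested_agreeing_arcCharts [T2Space X] [SecondCountableTopology X] [NoncompactSpace (F.Leaf x)]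
    (hbi : IsBiOriented F) :
    ∃ g : ℕ → OpenPartialHomeomorph (F.Leaf x) ℝ, (∀ n, (g n).target = univ) ∧
      (∀ n, (g n).source ⊆ (g (n + 1)).source) ∧ (⋃ n, (g n).source) = univ ∧
      (∀ n, StrictMono (g (n + 1) ∘ (g n).symm)) ∧ ∀ n, AgreesWithLeafArcs (g n) := by
  have harc : ∀ p : F.Leaf x, ∃ c : OpenPartialHomeomorph (F.Leaf x) ℝ, c.target = univ ∧ p ∈ c.source := fun p ↦ by
    obtain ⟨e, he, t, h, hp⟩ := exists_mem_leafArc_source p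
    exact ⟨leafArc e t h he, leafArc_target h he, hp⟩
  -- a nested exhausting sequence with increasing transitions (not yet oriented)
  obtain ⟨g, hgt, hgn, hgc, hgm⟩ : ∃ g : ℕ → OpenPartialHomeomorph (F.Leaf x) ℝ, (∀ n, (g n).target = univ) ∧
      (∀ n, (g n).source ⊆ (g (n + 1)).source) ∧ (⋃ n, (g n).source) = univ ∧
      ∀ n, StrictMono (g (n + 1) ∘ (g n).symm) := by
    by_cases hG : ∃ e₁ f₁ : OpenPartialHomeomorph (F.Leaf x) ℝ, e₁.target = univ ∧ f₁.target = univ ∧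
        e₁.source ∪ f₁.source = univ ∧
        ∀ q ∈ e₁.source ∩ f₁.source, ∀ᶠ r in 𝓝 q,
          (e₁ r < e₁ q ↔ f₁ r < f₁ q) ∧ (e₁ q < e₁ r ↔ f₁ q < f₁ r)
    · obtain ⟨e₁, f₁, he₁, hf₁, hcov, hcompat⟩ := hG
      obtain ⟨g₀, hg₀, hsrc⟩ := exists_global_arcChart_of_pair he₁ hf₁ hcov hcompat
      refine ⟨fun _ ↦ g₀, fun _ ↦ hg₀, fun _ ↦ Subset.rfl, ?_, fun _ ↦ ?_⟩
      · rw [iUnion_const, hsrc]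
      · intro s t hst
        simp only [Function.comp_apply, arc_apply_symm hg₀]
        exact hst
    · exact exists_arcCharts_nat_of_not_cover harc hG
  -- the sources increase
  have hsub0 : ∀ n, (g 0).source ⊆ (g n).source := by
    intro n
    induction n with
    | zero => exact Subset.rfl
    | succ k ih => exact ih.trans (hgn k)
  -- all `g n` agree locally with `g 0` on its source (increasing transitions)
  have hsame : ∀ n, ∀ p ∈ (g 0).source, LocAgree (g n) (g 0) p := by
    intro n
    induction n with
    | zero => exact fun p _ ↦ Eventually.of_forall fun q ↦ ⟨Iff.rfl, Iff.rfl⟩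
    | succ n ih =>
      intro p hp
      have hpn : p ∈ (g n).source := hsub0 n hp
      have h1 : LocAgree (g (n + 1)) (g n) p := by
        have h := eventually_lt_iff_of_strictMonoOn (e := g n) (c := g (n + 1)) isOpen_univ
          (by rw [hgt n]) ((hgm n).strictMonoOn univ) ⟨g n p, mem_univ _, (g n).left_inv hpn⟩
        exact h.mono fun q hq ↦ ⟨hq.1.symm, hq.2.symm⟩
      exact h1.trans (ih p hp)
  obtain ⟨p₀, hp₀⟩ := arc_source_nonempty (hgt 0)
  obtain ⟨e, he, t, h, hpc⟩ := exists_mem_leafArc_source p₀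
  rcases agrees_or_disagrees (g := g 0) hbi (hgt 0) with h0 | h0
  · refine ⟨g, hgt, hgn, hgc, hgm, fun n ↦ ?_⟩
    rcases agrees_or_disagrees (g := g n) hbi (hgt n) with hn | hn
    · exact hn
    · exfalso
      have a : LocAgree (g n) (leafArc e t h he) p₀ := (hsame n p₀ hp₀).trans (h0 p₀ hp₀ e he t h hpc)
      exact not_locAgree_of_locDisagree (leafArc_target h he) hpc a (hn p₀ (hsub0 n hp₀) e he t h hpc)
  · refine ⟨fun n ↦ (g n).transHomeomorph (Homeomorph.neg ℝ), fun n ↦ neg_chart_target (hgt n),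
      fun n ↦ hgn n, hgc, fun n ↦ strictMono_neg_transition (hgm n), fun n ↦ ?_⟩
    rcases agrees_or_disagrees (g := g n) hbi (hgt n) with hn | hn
    · exfalso
      have a : LocDisagree (g n) (leafArc e t h he) p₀ := (hsame n p₀ hp₀).trans_locDisagree (h0 p₀ hp₀ e he t h hpc)
      exact not_locAgree_of_locDisagree (leafArc_target h he) hpc (hn p₀ (hsub0 n hp₀) e he t h hpc) a
    · exact agreesWithLeafArcs_neg hn

end OpenLeaf

end Literature.Topology.PlanarFoliations
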